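import Summits.BirchSwinnertonDyer.BirchSwinnertonDyer.Theses.ShaPrimaryTransfer
import Summits.BirchSwinnertonDyer.BirchSwinnertonDyer.Theorems.ShaPrimaryTransferFiniteShaComponentTransferSectors
import Literature.NumberTheory.EllipticCurves.BurungaleKobayashiOta2024.SupersingularPConverse
import Literature.NumberTheory.EllipticCurves.BSDSelmerParityDokchitserProofs

/-!
# BirchSwinnertonDyer / ShaPrimaryTransfer — crux `FiniteShaComponentTransfer` (stmt-BirchSwinnertonDyer-22356):
# CM curves — every GOOD door prime `p ≥ 5` transfers in rank ≤ 1 (Burungale–Tian + Burungale–Kobayashi–Ota)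

Seventh helper file of prover seat `bsd-line-spt-p1` (`--supports stmt-22356 --as helper`). For CM curves the
companion `…Sectors` (g0) closes rank `0` at ANY door prime (Burungale–Tian 2026 Thm. 1.1) and rank `1` at good
ORDINARY `p ≥ 5` (Burungale–Tian 2020 Thm. 1.2). The tree also carries, verbatim and extended to CM by an arbitrary
order, Burungale–Kobayashi–Ota, JIMJ 23 (2024), Thm. 1.5 — the rank-one `p`-converse at good SUPERSINGULAR `p ≥ 5`
in the Ш-finite shape «`corank Sel_{p^∞} = 1 ∧ Ш[p^∞]` finite ⟹ `ord_{s=1} L = 1`» (`BurungaleKobayashiOta2024.thm15_of_hasCM`).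
Hence:

* `transfer_of_hasCM_rank_one_supersingular` — CM, rank `1`, door at a good supersingular `p ≥ 5`: `t_p(E) = 0 ⟹
  t_q(E) = 0` at every prime `q` (mod BKO 2024 Thm. 1.5 + GZK).
* `transfer_of_hasCM_rank_le_one_of_good_five_le` — CM, rank `≤ 1`, door at ANY GOOD prime `p ≥ 5` (ordinary or
  supersingular): the transfer holds, mod BT2026 (rank 0) / BT2020 (rank 1 ordinary; CM curves have `E[p]`
  irreducible there, tree theorem inside `…Sectors`) / BKO2024 (rank 1 supersingular) + GZK.

WHAT IS LEFT FOR CM CURVES (numbers, not adjectives): rank `1` with the door at `p ∈ {2, 3}` or at a BAD prime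
(for a CM curve every bad prime is additive — potentially good —, so the multiplicative door of `…DoorSkinnerC`
never applies and (ram) always fails), and rank ≥ 2. The first such cell, {CM by `ℤ[i]`, rank 1, door at the
additive prime 2}, is crux B of `CongruentShaFreeCut` (`…RepairCensus` §3). CONDITIONAL on the named hypotheses;
nothing here proves T or BSD.

References: A. Burungale, Y. Tian, Ann. of Math. 203 (2026), Thm. 1.1; A. Burungale, Y. Tian, Invent. Math. 220
(2020), Thm. 1.2; A. Burungale, S. Kobayashi, K. Ota, J. Inst. Math. Jussieu 23 (2024), Thm. 1.5; R. Greenberg,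
LNM 1716 (1999), §1; V. Kolyvagin (1990), Thm. A / Gross–Zagier (1986) via H. Darmon, CBMS 101 (2004), Thm. 3.22.
-/

-- D-0017: single-problem summit, so `Summit.BirchSwinnertonDyer.BirchSwinnertonDyer.…` repeats a namespace BY DESIGN.
set_option linter.dupNamespace false

noncomputable section

namespace Summit.BirchSwinnertonDyer.BirchSwinnertonDyer.Theorems.ShaPrimaryTransferDoorCM

open scoped Classical
open Literature.NumberTheory.EllipticCurves
open WeierstrassCurve
open Summit.BirchSwinnertonDyer.BirchSwinnertonDyer.Theorems

/-- **CM, rank `1`, door at a good SUPERSINGULAR prime `p ≥ 5` (BKO 2024 + GZK).** For a CM elliptic `E/ℚ` on a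
global minimal model with `rank E(ℚ) = 1`, a prime `p ≥ 5` of good supersingular reduction (`p ∣ a_p`) and
`t_p(E) = corank_{ℤ_p} Ш(E)[p^∞] = 0`: every `t_q(E)` vanishes. Proof: `corank Sel_{p^∞} = rank + t_p = 1`
(Greenberg's identity) and `Ш(E)[p^∞]` is finite (`finite_primaryComponent_sha_iff_shaCorank_eq_zero`), so
`ord_{s=1} L(E,s) = 1` by Burungale–Kobayashi–Ota Thm. 1.5 for CM by any order (`hBKO` through the tree theorem
`BurungaleKobayashiOta2024.thm15_of_hasCM`); Gross–Zagier–Kolyvagin (`hGZK`) makes `Ш(E/ℚ)` finite.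
CONDITIONAL on `hBKO`, `hGZK`. [cite: BurungaleKobayashiOta2023, Thm. 1.5 (JIMJ 23 (2024), p. 1422)]
[cite: Darmon2004, Thm. 3.22 (= Thm. 1.14) and §3.9] -/
theorem transfer_of_hasCM_rank_one_supersingular
    (hBKO : BurungaleKobayashiOta2024.thm15_analyticRank_eq_one_of_selmerCorank_eq_one)
    (hGZK : rank_eq_analyticRank_of_analyticRank_le_one)
    (W : WeierstrassCurve ℚ) [W.IsElliptic] [W.IsGloballyMinimal] (hCM : W.HasCM) (p q : ℕ) [Fact p.Prime]
    [Fact q.Prime] (hp : 5 ≤ p) (hgood : W.HasGoodReductionAtPrime p) (hss : (p : ℤ) ∣ W.frobeniusTrace p)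
    (hr : W.mordellWeilRank = 1) (h0 : W.shaCorank p = 0) : W.shaCorank q = 0 := by
  have hs : W.selmerCorank p = 1 := by
    rw [W.selmerCorank_eq_mordellWeilRank_add_holds p, hr, h0]
  have hfin : Finite (AddCommGroup.primaryComponent W.sha p) :=
    (finite_primaryComponent_sha_iff_shaCorank_eq_zero W p).2 h0
  have ha : W.analyticRank = 1 := BurungaleKobayashiOta2024.thm15_of_hasCM hBKO W hCM p hp hgood hss hs hfin
  haveI : Finite ↥W.sha := (hGZK W (by omega)).2
  exact W.shaCorank_eq_zero_of_finite q

/-- **CM, rank `≤ 1`, door at ANY GOOD prime `p ≥ 5`.** For a CM elliptic `E/ℚ` on a global minimal model with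
`rank E(ℚ) ≤ 1`, a prime `p ≥ 5` of good reduction (ordinary OR supersingular) and `t_p(E) = 0`: every `t_q(E)`
vanishes — rank `0` by Burungale–Tian 2026 Thm. 1.1 (`hBT0`, any prime; landed
`ShaPrimaryTransferSectors.transfer_of_hasCM_of_mordellWeilRank_eq_zero`), rank `1` ordinary by Burungale–Tian 2020
Thm. 1.2 (`hBT1`; landed `ShaPrimaryTransferSectors.transfer_of_mordellWeilRank_eq_one_of_goodOrdinary`, whose non-CM
input `hKim` is idle here), rank `1` supersingular by BKO 2024 Thm. 1.5 (`hBKO`), all closed by GZK (`hGZK`).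
CONDITIONAL on `hBT0`, `hBT1`, `hKim`, `hBKO`, `hGZK`. [cite: BurungaleTian2026, Thm. 1.1]
[cite: BurungaleTian2019, Thm. 1.2 (p. 214)] [cite: BurungaleKobayashiOta2023, Thm. 1.5 (JIMJ 23 (2024), p. 1422)]
[cite: Darmon2004, Thm. 3.22 (= Thm. 1.14) and §3.9] -/
theorem transfer_of_hasCM_rank_le_one_of_good_five_le
    (hBT0 : burungaleTian_analyticRank_eq_zero_of_selmerCorank_eq_zero_of_hasCM)
    (hBT1 : burungaleTian_analyticRank_eq_one_of_selmerCorank_eq_one_of_hasCM)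
    (hKim : kim_analyticRank_eq_one_of_mordellWeilRank_eq_one)
    (hBKO : BurungaleKobayashiOta2024.thm15_analyticRank_eq_one_of_selmerCorank_eq_one)
    (hGZK : rank_eq_analyticRank_of_analyticRank_le_one)
    (W : WeierstrassCurve ℚ) [W.IsElliptic] [W.IsGloballyMinimal] (hCM : W.HasCM) (p q : ℕ) [Fact p.Prime]
    [Fact q.Prime] (hp : 5 ≤ p) (hgood : W.HasGoodReductionAtPrime p) (hr : W.mordellWeilRank ≤ 1)
    (h0 : W.shaCorank p = 0) : W.shaCorank q = 0 := by
  rcases Nat.le_one_iff_eq_zero_or_eq_one.1 hr with hr0 | hr1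
  · exact ShaPrimaryTransferSectors.transfer_of_hasCM_of_mordellWeilRank_eq_zero hBT0 hGZK W hCM p q hr0 h0
  · by_cases hord : (p : ℤ) ∣ W.frobeniusTrace p
    · exact transfer_of_hasCM_rank_one_supersingular hBKO hGZK W hCM p q hp hgood hord hr1 h0
    · exact ShaPrimaryTransferSectors.transfer_of_mordellWeilRank_eq_one_of_goodOrdinary hKim hBT1 hGZK W p q
        (by omega) hgood hord (fun h => absurd hCM h) hr1 h0

/-- **The CM residue of T in door coordinates.** Granting the four CM `p`-converses and GZK, for CM curves on global
minimal models with `rank E(ℚ) ≤ 1` the transfer `t_p(E) = 0 ⟹ t_q(E) = 0` can fail only at a door prime `p` that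
is `< 5` or BAD for `E` (for CM curves: additive) — and only in rank `1` (rank `0`: any door, `hBT0`). Stated as the
implication «door at `p`, transfer fails ⟹ rank `= 1 ∧ (p < 5 ∨ ¬ good at p)`». CONDITIONAL.
[cite: BurungaleTian2026, Thm. 1.1] [cite: BurungaleTian2019, Thm. 1.2 (p. 214)]
[cite: BurungaleKobayashiOta2023, Thm. 1.5 (JIMJ 23 (2024), p. 1422)] -/
theorem cm_residue_of_transfer_failure
    (hBT0 : burungaleTian_analyticRank_eq_zero_of_selmerCorank_eq_zero_of_hasCM)
    (hBT1 : burungaleTian_analyticRank_eq_one_of_selmerCorank_eq_one_of_hasCM)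
    (hKim : kim_analyticRank_eq_one_of_mordellWeilRank_eq_one)
    (hBKO : BurungaleKobayashiOta2024.thm15_analyticRank_eq_one_of_selmerCorank_eq_one)
    (hGZK : rank_eq_analyticRank_of_analyticRank_le_one)
    (W : WeierstrassCurve ℚ) [W.IsElliptic] [W.IsGloballyMinimal] (hCM : W.HasCM) (p q : ℕ) [Fact p.Prime]
    [Fact q.Prime] (hr : W.mordellWeilRank ≤ 1) (h0 : W.shaCorank p = 0) (hq : W.shaCorank q ≠ 0) :
    W.mordellWeilRank = 1 ∧ (p < 5 ∨ ¬ W.HasGoodReductionAtPrime p) := by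
  rcases Nat.le_one_iff_eq_zero_or_eq_one.1 hr with hr0 | hr1
  · exact absurd (ShaPrimaryTransferSectors.transfer_of_hasCM_of_mordellWeilRank_eq_zero hBT0 hGZK W hCM p q hr0 h0)
      hq
  · refine ⟨hr1, ?_⟩
    by_contra hcon
    push Not at hcon
    exact hq (transfer_of_hasCM_rank_le_one_of_good_five_le hBT0 hBT1 hKim hBKO hGZK W hCM p q hcon.1 hcon.2 hr h0)

end Summit.BirchSwinnertonDyer.BirchSwinnertonDyer.Theorems.ShaPrimaryTransferDoorCM
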